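/-
Origin: expansion seat `planner-pub-hodgecm-prl2-g5-0`, handover #4 2026-08-18T08:12:52Z (`HOME/pub-hodgecm-prl2-g5/lean/Prl2g5/TwistOrbit.lean`, md5 c1b38f67, 320 lines);
landed by the gen-7 packager in gate run 26 as `HodgeCM/Automorphic/TwistOrbit.lean` (import ^import Prl2g5\.TwistSupport\b→import HodgeCM.Automorphic.TwistSupport ×1).
-/
/-
Copyright: pub-hodgecm expansion lineage prl2 (REDUCE `RealisationExistsPerL` / `Face`), generation 5.
Authors: planner-pub-hodgecm-prl2-g5-0.

# The twist-average decomposition — DEEP SUPPORT (`IsoDatum.CompTower.deepen`) in the kernel, from primitive seams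

ADDITIVE leaf over `TwistSupport` (gen 5, HANDOVER #3).  `HodgeCM.StubTree.ComponentTower` posits the (P∘U) clause
`CompTower.deepen` as ONE composite seam and derives it in prose (REDUCTION-v5 §M1(c)).  This file proves the abstract
content of that derivation in the kernel, so that `deepen` is the conjunction of PRIMITIVE one-line dictionary entries
(listed below) and a theorem.  Setting (all abstract; no automorphic object is constructed):

* `W : ι → Submodule ℂ H` a pairwise-orthogonal family (`OrthFamily`) — model: the isotypic components of the classes
  of one block;
* a finite group `X` acting on `ι` and by a unitary representation `U : X →* (H →L[ℂ] H)` on `H` with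
  `U χ (W i) ⊆ W (χ • i)` — model: `X = Ĉ_{K″}`, `U_χ` = multiplication by `χ∘det`, `χ • τ = τ ⊗ χ∘det`
  (`R(g)U_χ = χ(det g)U_χR(g)`);
* a group `K` acting by a unitary representation `ρ` preserving each `W i`, with `ρ k ∘ U χ = c χ k • (U χ ∘ ρ k)` —
  model: `K = K′` through `R`, `c χ k = χ(det k)`;
* a subgroup `X′ ≤ X` with `c χ = c ψ → χ⁻¹ψ ∈ X′` — model: `Ĉ_{K′}` (a character of `T(L⁺)\T(𝔸_f)` trivial on
  `det K′` lies in `Ĉ_{K′}`);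
* a vector `v = Σ_{i ∈ O} d′ i`, `d′ i ∈ W i`, on an `X`-stable finite set `O`, fixed by `U(X′)` and by `ρ(K)` — model:
  `v = vec d`, `O = Ĉ″·supp(d)`, `d′` = the isotypic components of `vec d` extended by zero.

Results: `twistAvg U v := |X|⁻¹ Σ_χ U χ v` (model: `e₁″(vec d) = vec(F′^*d)`, the cut-off identity of §M1(a)) equals
`Σ_{j ∈ O} twistComp U d′ j` with `twistComp U d′ j = |X|⁻¹ Σ_χ U χ (d′(χ⁻¹ • j)) ∈ W j` (`twistAvg_eq_sum_twistComp`,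
`twistComp_mem`), and **every component over the orbit of the support is nonzero** (`twistComp_ne_zero`: the summands
are `ρ`-eigenvectors, equal on `X′`-cosets, with coset-separated characters — `TwistSupport`).  `twist_deepen` packages
this in the exact ∃-shape of `CompTower.deepen` (the `c`-side membership and the `d`-side decomposition with all
components nonzero).  Kernel-checked, standard axioms only; imports `TwistSupport` only.
-/
import Summits.HodgeConjecture.HodgeCM.Automorphic.TwistSupport

noncomputable section

open scoped BigOperators InnerProductSpace ComplexConjugate

namespace HodgeCM

namespace RepDecomp

open HodgeCM.PerL34.Spectral (IsUnitaryRep)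

variable {H : Type*} [NormedAddCommGroup H] [InnerProductSpace ℂ H]

/-! ## 1. Pairwise orthogonal families: termwise uniqueness of finite decompositions -/

/-- A family of subspaces is **pairwise orthogonal**. -/
def OrthFamily {ι : Type*} (W : ι → Submodule ℂ H) : Prop :=
  ∀ ⦃i j : ι⦄, i ≠ j → ∀ u ∈ W i, ∀ v ∈ W j, ⟪u, v⟫_ℂ = 0

namespace OrthFamily

variable {ι : Type*} {W : ι → Submodule ℂ H}

/-- A finite sum of vectors from pairwise orthogonal subspaces vanishes only if every summand does. -/
theorem eq_zero_of_sum_eq_zero (hW : OrthFamily W) {s : Finset ι} {f : ι → H}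
    (hf : ∀ i ∈ s, f i ∈ W i) (h0 : ∑ i ∈ s, f i = 0) : ∀ i ∈ s, f i = 0 := by
  intro i hi
  have h : ⟪f i, ∑ j ∈ s, f j⟫_ℂ = ⟪f i, f i⟫_ℂ := by
    rw [inner_sum]
    exact Finset.sum_eq_single i (fun j hj hne => hW (Ne.symm hne) _ (hf i hi) _ (hf j hj))
      (fun h => absurd hi h)
  rw [h0, inner_zero_right] at h
  exact inner_self_eq_zero.mp h.symm

/-- **Termwise uniqueness**: two finite decompositions along a pairwise orthogonal family with the same sum agree
term by term. -/
theorem eq_of_sum_eq_sum (hW : OrthFamily W) {s : Finset ι} {f g : ι → H}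
    (hf : ∀ i ∈ s, f i ∈ W i) (hg : ∀ i ∈ s, g i ∈ W i) (h : ∑ i ∈ s, f i = ∑ i ∈ s, g i) :
    ∀ i ∈ s, f i = g i := by
  have h0 : ∑ i ∈ s, (f i - g i) = 0 := by
    rw [Finset.sum_sub_distrib, h, sub_self]
  intro i hi
  exact sub_eq_zero.mp
    (hW.eq_zero_of_sum_eq_zero (fun j hj => Submodule.sub_mem _ (hf j hj) (hg j hj)) h0 i hi)

end OrthFamily

/-! ## 2. Sums of eigenvectors that are constant on the fibres of the character map -/

section Fibers

variable {K : Type*} [Group K] {ρ : K →* (H →L[ℂ] H)}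

/-- **A finite sum of `ρ`-eigenvectors is nonzero** as soon as one summand is, provided summands with the same
character are EQUAL (then the sum regroups into positive multiples of eigenvectors with pairwise distinct characters,
and `sum_ne_zero_of_eigen_pairwise_ne` applies). -/
theorem sum_ne_zero_of_eigen_fibers (hρ : IsUnitaryRep ρ) {X : Type*} (s : Finset X) (w : X → H)
    (c : X → K → ℂ) (hw : ∀ χ ∈ s, ∀ k, ρ k (w χ) = c χ k • w χ)
    (hc : ∀ χ ∈ s, ∀ ψ ∈ s, c χ = c ψ → w χ = w ψ) {χ₀ : X} (hχ₀ : χ₀ ∈ s) (h0 : w χ₀ ≠ 0) :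
    ∑ χ ∈ s, w χ ≠ 0 := by
  classical
  rw [← Finset.sum_fiberwise_of_maps_to (fun χ hχ => Finset.mem_image_of_mem c hχ) w]
  refine sum_ne_zero_of_eigen_pairwise_ne hρ (s.image c) (fun y => ∑ χ ∈ s with c χ = y, w χ) (fun y => y)
    ?_ ?_ (Finset.mem_image_of_mem c hχ₀) ?_
  · intro y _ k
    rw [map_sum, Finset.smul_sum]
    refine Finset.sum_congr rfl (fun χ hχ => ?_)
    rw [Finset.mem_filter] at hχ
    rw [hw χ hχ.1 k, hχ.2]
  · intro y _ y' _ hne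
    exact Function.ne_iff.mp hne
  · have hconst : ∀ χ ∈ s.filter (fun χ => c χ = c χ₀), w χ = w χ₀ := by
      intro χ hχ
      rw [Finset.mem_filter] at hχ
      exact hc χ hχ.1 χ₀ hχ₀ hχ.2
    rw [Finset.sum_congr rfl hconst, Finset.sum_const, ← Nat.cast_smul_eq_nsmul ℂ]
    refine smul_ne_zero (Nat.cast_ne_zero.mpr ?_) h0
    exact Finset.card_ne_zero.mpr ⟨χ₀, Finset.mem_filter.mpr ⟨hχ₀, rfl⟩⟩

end Fibers

/-! ## 3. The twist average and its components -/

section TwistAverage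

variable {ι X : Type*} [Group X] [Fintype X] [MulAction X ι]

/-- A finite set of indices is `X`-stable. -/
def StableFinset (X : Type*) [Group X] [MulAction X ι] (O : Finset ι) : Prop := ∀ (χ : X) (j : ι), χ • j ∈ O ↔ j ∈ O

/-- The finite set `X • s` (the orbit of a finite set under a finite group). -/
def orbitFinset (X : Type*) [Group X] [Fintype X] [MulAction X ι] [DecidableEq ι] (s : Finset ι) : Finset ι :=
  (Finset.univ ×ˢ s).image (fun p : X × ι => p.1 • p.2)

section Orbit

variable [DecidableEq ι]

/-- (Ported verbatim from the HodgeCMPerL package; no docstring in the source.) -/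
theorem mem_orbitFinset {s : Finset ι} {j : ι} :
    j ∈ orbitFinset X s ↔ ∃ (χ : X) (i : ι), i ∈ s ∧ χ • i = j := by
  unfold orbitFinset
  simp only [Finset.mem_image, Finset.mem_product, Finset.mem_univ, true_and, Prod.exists]

/-- (Ported verbatim from the HodgeCMPerL package; no docstring in the source.) -/
theorem subset_orbitFinset (s : Finset ι) : s ⊆ orbitFinset X s := by
  intro i hi
  exact mem_orbitFinset.mpr ⟨1, i, hi, one_smul _ _⟩

/-- (Ported verbatim from the HodgeCMPerL package; no docstring in the source.) -/
theorem smul_mem_orbitFinset_iff (s : Finset ι) (χ : X) (j : ι) :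
    χ • j ∈ orbitFinset X s ↔ j ∈ orbitFinset X s := by
  constructor
  · intro h
    obtain ⟨ψ, i, hi, hψ⟩ := mem_orbitFinset.mp h
    refine mem_orbitFinset.mpr ⟨χ⁻¹ * ψ, i, hi, ?_⟩
    rw [mul_smul, hψ, inv_smul_smul]
  · intro h
    obtain ⟨ψ, i, hi, hψ⟩ := mem_orbitFinset.mp h
    refine mem_orbitFinset.mpr ⟨χ * ψ, i, hi, ?_⟩
    rw [mul_smul, hψ]

omit [Fintype X] [DecidableEq ι] in
/-- (Ported verbatim from the HodgeCMPerL package; no docstring in the source.) -/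
theorem StableFinset.smul_mem {O : Finset ι} (hO : StableFinset X O) (χ : X) {j : ι} (hj : j ∈ O) : χ • j ∈ O :=
  (hO χ j).mpr hj

/-- (Ported verbatim from the HodgeCMPerL package; no docstring in the source.) -/
theorem stableFinset_orbitFinset (s : Finset ι) : StableFinset X (orbitFinset X s) :=
  fun χ j => smul_mem_orbitFinset_iff s χ j

end Orbit

variable (U : X →* (H →L[ℂ] H))

/-- The **twist average** `|X|⁻¹ Σ_χ U χ v` (model: `e₁^{K″}`, multiplication by the indicator of the identity
component, §M1(a)). -/
def twistAvg (v : H) : H := (Fintype.card X : ℂ)⁻¹ • ∑ χ : X, U χ v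

/-- The **`j`-component of the twist average** of `Σ_i d′ i`: `|X|⁻¹ Σ_χ U χ (d′ (χ⁻¹ • j))`. -/
def twistComp (d' : ι → H) (j : ι) : H := (Fintype.card X : ℂ)⁻¹ • ∑ χ : X, U χ (d' (χ⁻¹ • j))

variable {U}

omit [Fintype X] in
/-- Reindexing along the action: `Σ_{j ∈ O} U χ (d′ (χ⁻¹ • j)) = Σ_{i ∈ O} U χ (d′ i)` on an `X`-stable `O`. -/
theorem sum_twist_reindex {O : Finset ι} (hO : StableFinset X O) (d' : ι → H) (χ : X) :
    ∑ j ∈ O, U χ (d' (χ⁻¹ • j)) = ∑ i ∈ O, U χ (d' i) := by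
  symm
  refine Finset.sum_equiv (MulAction.toPerm χ) (fun i => ?_) (fun i _ => ?_)
  · change i ∈ O ↔ χ • i ∈ O
    exact (hO χ i).symm
  · change U χ (d' i) = U χ (d' (χ⁻¹ • (χ • i)))
    rw [inv_smul_smul]

/-- **The twist average is the sum of its components over the (stable) support.** -/
theorem twistAvg_eq_sum_twistComp {O : Finset ι} (hO : StableFinset X O) (d' : ι → H) :
    twistAvg U (∑ i ∈ O, d' i) = ∑ j ∈ O, twistComp U d' j := by
  unfold twistAvg twistComp
  rw [← Finset.smul_sum, Finset.sum_comm]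
  congr 1
  refine Finset.sum_congr rfl (fun χ _ => ?_)
  rw [map_sum, sum_twist_reindex hO d' χ]

variable (W : ι → Submodule ℂ H)

/-- Each component lies in its subspace: `twistComp U d′ j ∈ W j` when `U χ (W i) ⊆ W (χ • i)` and `d′ i ∈ W i`. -/
theorem twistComp_mem (hUW : ∀ (χ : X) (i : ι) (v : H), v ∈ W i → U χ v ∈ W (χ • i))
    (d' : ι → H) (hd' : ∀ i, d' i ∈ W i) (j : ι) : twistComp U d' j ∈ W j := by
  unfold twistComp
  refine Submodule.smul_mem _ _ (Submodule.sum_mem _ (fun χ _ => ?_))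
  have h := hUW χ (χ⁻¹ • j) (d' (χ⁻¹ • j)) (hd' _)
  rwa [smul_inv_smul] at h

variable {K : Type*} [Group K]

/-- **Every component of the twist average over the orbit of the support is nonzero.**  Hypotheses: `W` pairwise
orthogonal; `U` unitary moving `W i` into `W (χ • i)`; `ρ` unitary preserving each `W i` with
`ρ k (U χ v) = c χ k • U χ (ρ k v)`; characters separate `X′`-cosets (`c χ = c ψ → χ⁻¹ * ψ ∈ X′`); the vector
`v = Σ_{i ∈ O} d′ i` (`d′ i ∈ W i`, `d′ = 0` off the `X`-stable `O`) is fixed by `U(X′)` and by `ρ(K)`; and `j ∈ O` is in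
the orbit of the support (`d′ (χ₀⁻¹ • j) ≠ 0` for some `χ₀`).  Then `twistComp U d′ j ≠ 0`. -/
theorem twistComp_ne_zero (hW : OrthFamily W) (hU : IsUnitaryRep U)
    (hUW : ∀ (χ : X) (i : ι) (v : H), v ∈ W i → U χ v ∈ W (χ • i))
    {ρ : K →* (H →L[ℂ] H)} (hρ : IsUnitaryRep ρ) (hρW : ∀ (k : K) (i : ι) (v : H), v ∈ W i → ρ k v ∈ W i)
    (c : X → K → ℂ) (hcomm : ∀ (χ : X) (k : K) (v : H), ρ k (U χ v) = c χ k • U χ (ρ k v))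
    (X' : Subgroup X) (hsep : ∀ χ ψ : X, c χ = c ψ → χ⁻¹ * ψ ∈ X')
    {O : Finset ι} (hO : StableFinset X O) (d' : ι → H) (hd' : ∀ i, d' i ∈ W i)
    (hfixU : ∀ η ∈ X', U η (∑ i ∈ O, d' i) = ∑ i ∈ O, d' i) (hfixρ : ∀ k : K, ρ k (∑ i ∈ O, d' i) = ∑ i ∈ O, d' i)
    {j : ι} (hj : j ∈ O) {χ₀ : X} (hχ₀ : d' (χ₀⁻¹ • j) ≠ 0) : twistComp U d' j ≠ 0 := by
  -- (i) `ρ` fixes every component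
  have hρd : ∀ (k : K), ∀ i ∈ O, ρ k (d' i) = d' i := by
    intro k
    refine hW.eq_of_sum_eq_sum (fun i _ => hρW k i _ (hd' i)) (fun i _ => hd' i) ?_
    rw [← map_sum, hfixρ k]
  -- (ii) `U η`, `η ∈ X′`, permutes the components along the action
  have hUd : ∀ η ∈ X', ∀ i ∈ O, U η (d' (η⁻¹ • i)) = d' i := by
    intro η hη
    refine hW.eq_of_sum_eq_sum (fun i _ => ?_) (fun i _ => hd' i) ?_
    · have h := hUW η (η⁻¹ • i) _ (hd' (η⁻¹ • i))
      rwa [smul_inv_smul] at h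
    · rw [sum_twist_reindex hO d' η, ← map_sum, hfixU η hη]
  -- (iii) the summands `w χ := U χ (d′ (χ⁻¹ • j))`
  have hsum : ∑ χ : X, U χ (d' (χ⁻¹ • j)) ≠ 0 := by
    refine sum_ne_zero_of_eigen_fibers hρ Finset.univ (fun χ => U χ (d' (χ⁻¹ • j))) c
      (fun χ _ k => ?_) (fun χ _ ψ _ hcψ => ?_) (Finset.mem_univ χ₀) ?_
    · -- eigenvector with character `c χ`
      rw [hcomm, hρd k _ ((hO χ⁻¹ j).mpr hj)]
    · -- equal characters ⇒ equal summands
      have hη : χ⁻¹ * ψ ∈ X' := hsep χ ψ hcψ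
      have hUψ : U ψ = U χ * U (χ⁻¹ * ψ) := by rw [← map_mul, mul_inv_cancel_left]
      have hψj : ψ⁻¹ • j = (χ⁻¹ * ψ)⁻¹ • (χ⁻¹ • j) := by rw [← mul_smul, mul_inv_rev, inv_inv, mul_inv_cancel_right]
      change U χ (d' (χ⁻¹ • j)) = U ψ (d' (ψ⁻¹ • j))
      rw [hUψ, hψj]
      change U χ (d' (χ⁻¹ • j)) = U χ (U (χ⁻¹ * ψ) (d' ((χ⁻¹ * ψ)⁻¹ • (χ⁻¹ • j))))
      rw [hUd _ hη _ ((hO χ⁻¹ j).mpr hj)]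
    · -- the `χ₀` summand is nonzero (`U χ₀` is injective)
      intro h0
      apply hχ₀
      have hn := RepDecomp.norm_map hU χ₀ (d' (χ₀⁻¹ • j))
      rw [h0, norm_zero] at hn
      exact norm_eq_zero.mp hn.symm
  unfold twistComp
  refine smul_ne_zero (inv_ne_zero (Nat.cast_ne_zero.mpr Fintype.card_ne_zero)) hsum

/-- **DEEP SUPPORT in the kernel (the ∃-shape of `IsoDatum.CompTower.deepen`).**  For the `d`-side datum as in
`twistComp_ne_zero` with support `s` (all `d i ≠ 0` on `s`, `d′ = d` on `s` and `0` elsewhere, `O = X • s`) and a `c`-side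
vector `Σ_{i ∈ t} e′ i` supported INSIDE the same orbit (`t ⊆ X • s`; model: `supp(c)` and `supp(d)` lie in one
`Ĉ″`-orbit — the block is a twist orbit and `K″` is deep enough), whose twist average is nonzero (model: `vec` and
pull-back along a covering are injective): the twist average of the `d`-vector is a finite sum of NONZERO vectors
`e j ∈ W j` over `S = X • s`, and the twist average of the `c`-vector lies in `⨆_{j ∈ S} W j`. -/
theorem twist_deepen [DecidableEq ι] (hW : OrthFamily W) (hU : IsUnitaryRep U)
    (hUW : ∀ (χ : X) (i : ι) (v : H), v ∈ W i → U χ v ∈ W (χ • i))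
    {ρ : K →* (H →L[ℂ] H)} (hρ : IsUnitaryRep ρ) (hρW : ∀ (k : K) (i : ι) (v : H), v ∈ W i → ρ k v ∈ W i)
    (c : X → K → ℂ) (hcomm : ∀ (χ : X) (k : K) (v : H), ρ k (U χ v) = c χ k • U χ (ρ k v))
    (X' : Subgroup X) (hsep : ∀ χ ψ : X, c χ = c ψ → χ⁻¹ * ψ ∈ X')
    (s : Finset ι) (d : ι → H) (hd : ∀ i ∈ s, d i ∈ W i) (hd0 : ∀ i ∈ s, d i ≠ 0)
    (hfixU : ∀ η ∈ X', U η (∑ i ∈ s, d i) = ∑ i ∈ s, d i) (hfixρ : ∀ k : K, ρ k (∑ i ∈ s, d i) = ∑ i ∈ s, d i)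
    (t : Finset ι) (e' : ι → H) (he' : ∀ i ∈ t, e' i ∈ W i) (ht : t ⊆ orbitFinset X s)
    (hc0 : twistAvg U (∑ i ∈ t, e' i) ≠ 0) :
    ∃ (S : Finset ι) (e : ι → H), (∀ j ∈ S, e j ∈ W j) ∧ (∀ j ∈ S, e j ≠ 0) ∧
      twistAvg U (∑ i ∈ s, d i) = ∑ j ∈ S, e j ∧
      twistAvg U (∑ i ∈ t, e' i) ∈ (⨆ j ∈ S, W j) ∧ twistAvg U (∑ i ∈ t, e' i) ≠ 0 := by
  have hO : StableFinset X (orbitFinset X s) := stableFinset_orbitFinset s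
  -- extend both families by zero
  let d' : ι → H := fun i => if i ∈ s then d i else 0
  let c' : ι → H := fun i => if i ∈ t then e' i else 0
  have hd' : ∀ i, d' i ∈ W i := by
    intro i
    by_cases hi : i ∈ s
    · simp only [d', hi, if_true]; exact hd i hi
    · simp only [d', hi, if_false]; exact Submodule.zero_mem _
  have hc' : ∀ i, c' i ∈ W i := by
    intro i
    by_cases hi : i ∈ t
    · simp only [c', hi, if_true]; exact he' i hi
    · simp only [c', hi, if_false]; exact Submodule.zero_mem _
  have hvd : ∑ i ∈ s, d i = ∑ i ∈ orbitFinset X s, d' i := by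
    have h1 : ∑ i ∈ s, d i = ∑ i ∈ s, d' i :=
      Finset.sum_congr rfl (fun i hi => by simp only [d', hi, if_true])
    rw [h1]
    exact Finset.sum_subset (subset_orbitFinset s) (fun i _ hi => by simp only [d', hi, if_false])
  have hvc : ∑ i ∈ t, e' i = ∑ i ∈ orbitFinset X s, c' i := by
    have h1 : ∑ i ∈ t, e' i = ∑ i ∈ t, c' i :=
      Finset.sum_congr rfl (fun i hi => by simp only [c', hi, if_true])
    rw [h1]
    exact Finset.sum_subset ht (fun i _ hi => by simp only [c', hi, if_false])
  have hfixU' : ∀ η ∈ X', U η (∑ i ∈ orbitFinset X s, d' i) = ∑ i ∈ orbitFinset X s, d' i := by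
    intro η hη; rw [← hvd]; exact hfixU η hη
  have hfixρ' : ∀ k : K, ρ k (∑ i ∈ orbitFinset X s, d' i) = ∑ i ∈ orbitFinset X s, d' i := by
    intro k; rw [← hvd]; exact hfixρ k
  refine ⟨orbitFinset X s, twistComp U d', fun j _ => twistComp_mem W hUW d' hd' j, ?_, ?_, ?_, hc0⟩
  · -- every component over the orbit is nonzero
    intro j hj
    obtain ⟨χ, i, hi, hχ⟩ := mem_orbitFinset.mp hj
    refine twistComp_ne_zero W hW hU hUW hρ hρW c hcomm X' hsep hO d' hd' hfixU' hfixρ' hj (χ₀ := χ) ?_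
    rw [← hχ, inv_smul_smul]
    simp only [d', hi, if_true]
    exact hd0 i hi
  · -- the `d`-average is the sum of its components
    rw [hvd]
    exact twistAvg_eq_sum_twistComp hO d'
  · -- the `c`-average lies in the span of the orbit's subspaces
    rw [hvc, twistAvg_eq_sum_twistComp hO c']
    refine Submodule.sum_mem _ (fun j hj => ?_)
    have hm : twistComp U c' j ∈ W j := twistComp_mem W hUW c' hc' j
    exact Submodule.mem_iSup_of_mem j (Submodule.mem_iSup_of_mem hj hm)

end TwistAverage

end RepDecomp

end HodgeCM

end
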